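import Summits.AnomalousDissipation.AnomalousDissipation.Theorems.SawtoothPulseCascadeK1LocalisedCascadeKHForcingPieces

/-!
# K2 lane (route-2 `SawtoothPulseCascade`, crux dir `K1LocalisedCascade`): corner numerics of the Bloch factor and the transport phase on the three affine pieces

Helper file of the K2 lane (ACL item stmt-AnomalousDissipation-19491; arbiter A28-11, the corner law).  Two small tool boxes for the corner strip
`0 < a ≤ 1/16`, `|b| ≤ ½`:
* §1 the numerics of `z = e^{2πib}`, `q = e^{−2πa}` at the corner: `q ≥ ½`, `1 − q ≥ πa`, `‖1 − zq‖ ≥ πa` and the POLE-CANCELLATION inequality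
  `πa + ‖e^{iπb} − 1‖ ≤ 2‖1 − zq‖` (the numerator of the antisymmetric kernel-derivative pair of `…KHKernelBlochDeriv` against its denominator);
* §2 the derivative of `triWave` on the three open pieces of `(−½, ½)` (slopes `1` on the centre, `−1` on trough and crest), hence of the transport
  phase `e^{−2πias·tri(y)}`, and `fract(x) ≠ 0` for `0 < |x| < 1`.
No definitions; no statement about the crux. [cite: ElgindiLissMattingly2025, §1 (H_α, V_α)] [problem: turb]
-/

-- `Summit.<Summit>.<Problem>`: single-conjunct summit, the duplicate namespace segment is deliberate.
set_option linter.dupNamespace false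

noncomputable section

namespace Summit.AnomalousDissipation.AnomalousDissipation.Theorems.SawtoothPulseCascade.K2PhaseBudget

open Set MeasureTheory intervalIntegral Literature.Analysis.FluidPDE.SawtoothCascade

/-! ## §1 Corner numerics: `q ≥ ½`, `‖1 − zq‖ ≥ πa`, `πa + ‖e^{iπb} − 1‖ ≤ 2‖1 − zq‖` -/

/-- For `0 < a ≤ 1/16`: `q = e^{−2πa} ≥ ½` and `1 − q ≥ πa`. [folklore] -/
theorem corner_q_bounds {a : ℝ} (ha : 0 < a) (ha1 : a ≤ 1 / 16) :
    1 / 2 ≤ Real.exp (-(2 * Real.pi * a)) ∧ Real.pi * a ≤ 1 - Real.exp (-(2 * Real.pi * a)) := by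
  have hπ := Real.pi_pos
  have hπ4 := Real.pi_lt_four
  have hq : 1 - 2 * Real.pi * a ≤ Real.exp (-(2 * Real.pi * a)) := by have := Real.add_one_le_exp (-(2 * Real.pi * a)); linarith
  have hq' : 1 / 2 ≤ Real.exp (-(2 * Real.pi * a)) := by nlinarith
  refine ⟨hq', ?_⟩
  -- `1 − e^{−x} ≥ x e^{−x}` from `e^{x} ≥ 1 + x`
  have h1 : 2 * Real.pi * a * Real.exp (-(2 * Real.pi * a)) ≤ 1 - Real.exp (-(2 * Real.pi * a)) := by
    have h := Real.add_one_le_exp (2 * Real.pi * a)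
    have he : Real.exp (2 * Real.pi * a) * Real.exp (-(2 * Real.pi * a)) = 1 := by rw [← Real.exp_add, add_neg_cancel, Real.exp_zero]
    nlinarith [Real.exp_pos (-(2 * Real.pi * a))]
  nlinarith [mul_le_mul_of_nonneg_left hq' (by positivity : (0 : ℝ) ≤ 2 * Real.pi * a)]

/-- For `0 < a ≤ 1/16`: `‖1 − zq‖ ≥ πa` (`z = e^{2πib}`, `q = e^{−2πa}`). [folklore] -/
theorem pi_mul_le_norm_one_sub_zq {a : ℝ} (ha : 0 < a) (ha1 : a ≤ 1 / 16) (b : ℝ) :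
    Real.pi * a ≤ ‖1 - Complex.exp (2 * Real.pi * b * Complex.I) * (Real.exp (-(2 * Real.pi * a)) : ℂ)‖ := by
  have hz : ‖Complex.exp (2 * Real.pi * b * Complex.I)‖ = 1 := by
    rw [show (2 * Real.pi * b * Complex.I : ℂ) = ((2 * Real.pi * b : ℝ) : ℂ) * Complex.I by push_cast; ring]
    exact Complex.norm_exp_ofReal_mul_I _
  have h := norm_sub_norm_le (1 : ℂ) (Complex.exp (2 * Real.pi * b * Complex.I) * (Real.exp (-(2 * Real.pi * a)) : ℂ))
  rw [norm_one, norm_mul, hz, one_mul, Complex.norm_real, Real.norm_eq_abs, abs_of_pos (Real.exp_pos _)] at h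
  linarith [(corner_q_bounds ha ha1).2]

/-- **The pole-cancellation numerics:** for `0 < a ≤ 1/16` and `|b| ≤ ½`, `πa + ‖e^{iπb} − 1‖ ≤ 2‖1 − zq‖` — the numerator of the antisymmetric
derivative pair (`…KHKernelBlochDeriv`) is dominated by its denominator uniformly at the corner. [folklore] -/
theorem corner_pair_numerics {a : ℝ} (ha : 0 < a) (ha1 : a ≤ 1 / 16) {b : ℝ} (hb : |b| ≤ 1 / 2) :
    Real.pi * a + ‖Complex.exp (((Real.pi * b : ℝ) : ℂ) * Complex.I) - 1‖ ≤
      2 * ‖1 - Complex.exp (2 * Real.pi * b * Complex.I) * (Real.exp (-(2 * Real.pi * a)) : ℂ)‖ := by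
  set q : ℝ := Real.exp (-(2 * Real.pi * a)) with hq
  set c : ℝ := Real.cos (Real.pi * b) with hc
  set s₁ : ℝ := ‖Complex.exp (((Real.pi * b : ℝ) : ℂ) * Complex.I) - 1‖ with hs₁
  set N₁ : ℝ := ‖1 - Complex.exp (2 * Real.pi * b * Complex.I) * (q : ℂ)‖ with hN₁
  have hπ := Real.pi_pos
  obtain ⟨hq2, h1q⟩ := corner_q_bounds ha ha1
  have hc0 : 0 ≤ c := by
    rw [hc]; apply Real.cos_nonneg_of_neg_pi_div_two_le_of_le <;> nlinarith [abs_le.1 hb]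
  have hc1 : c ≤ 1 := Real.cos_le_one _
  -- the two squared norms in closed form
  have hs₁sq : s₁ ^ 2 = 2 - 2 * c := by
    rw [hs₁, ← Complex.normSq_eq_norm_sq, Complex.normSq_apply]
    simp only [Complex.sub_re, Complex.sub_im, Complex.one_re, Complex.one_im, Complex.exp_ofReal_mul_I_re, Complex.exp_ofReal_mul_I_im, sub_zero]
    nlinarith [Real.sin_sq_add_cos_sq (Real.pi * b)]
  have hN₁sq : N₁ ^ 2 = 1 - 2 * q * Real.cos (2 * Real.pi * b) + q ^ 2 := by
    rw [hN₁, ← Complex.normSq_eq_norm_sq, show (2 * Real.pi * b * Complex.I : ℂ) = ((2 * Real.pi * b : ℝ) : ℂ) * Complex.I by push_cast; ring,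
      Complex.normSq_apply]
    simp only [Complex.sub_re, Complex.sub_im, Complex.one_re, Complex.one_im, Complex.mul_re, Complex.mul_im, Complex.exp_ofReal_mul_I_re,
      Complex.exp_ofReal_mul_I_im, Complex.ofReal_re, Complex.ofReal_im, mul_zero, sub_zero, zero_sub]
    nlinarith [Real.sin_sq_add_cos_sq (2 * Real.pi * b)]
  have hcos2 : Real.cos (2 * Real.pi * b) = 2 * c ^ 2 - 1 := by
    rw [hc, show 2 * Real.pi * b = 2 * (Real.pi * b) by ring, Real.cos_two_mul]
  have hs0 : 0 ≤ s₁ := norm_nonneg _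
  have hN0 : 0 ≤ N₁ := norm_nonneg _
  -- `(πa + s₁)² ≤ 2π²a² + 2s₁² ≤ 4(1−q)² + 8q(1 − cos 2πb) = 4N₁²`
  have hsq : (Real.pi * a + s₁) ^ 2 ≤ (2 * N₁) ^ 2 := by
    have e1 : (Real.pi * a + s₁) ^ 2 ≤ 2 * (Real.pi * a) ^ 2 + 2 * s₁ ^ 2 := by nlinarith [sq_nonneg (Real.pi * a - s₁)]
    have e2 : 2 * (Real.pi * a) ^ 2 ≤ 4 * (1 - q) ^ 2 := by
      have hpa : 0 ≤ Real.pi * a := by positivity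
      nlinarith [mul_le_mul h1q h1q hpa (hpa.trans h1q)]
    have e3 : 2 * s₁ ^ 2 ≤ 8 * q * (1 - Real.cos (2 * Real.pi * b)) := by
      rw [hs₁sq, hcos2]
      nlinarith [mul_nonneg (mul_nonneg (by linarith : (0 : ℝ) ≤ 1 - c) hc0) (by linarith : (0 : ℝ) ≤ q)]
    nlinarith
  nlinarith [sq_nonneg (Real.pi * a + s₁ - 2 * N₁), sq_nonneg (Real.pi * a + s₁ + 2 * N₁)]

/-! ## §2 The triangle wave and the transport phase on the three open pieces -/

/-- `tri' = 1` on the centre piece. [cite: ElgindiLissMattingly2025, §1 (H_α, V_α)] -/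
theorem hasDerivAt_triWave_centre {y : ℝ} (hy : y ∈ Ioo (-(1 / 4 : ℝ)) (1 / 4)) : HasDerivAt triWave 1 y := by
  have hev : triWave =ᶠ[nhds y] fun t => t := by
    filter_upwards [Ioo_mem_nhds hy.1 hy.2] with t ht
    exact triWave_eq_self ht.1.le ht.2.le
  exact (hasDerivAt_id y).congr_of_eventuallyEq hev

/-- `tri' = −1` on the crest piece. [cite: ElgindiLissMattingly2025, §1 (H_α, V_α)] -/
theorem hasDerivAt_triWave_crest {y : ℝ} (hy : y ∈ Ioo (1 / 4 : ℝ) (3 / 4)) : HasDerivAt triWave (-1) y := by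
  have hev : triWave =ᶠ[nhds y] fun t => 1 / 2 - t := by
    filter_upwards [Ioo_mem_nhds hy.1 hy.2] with t ht
    exact triWave_eq_half_sub ht.1.le ht.2.le
  have h : HasDerivAt (fun t : ℝ => 1 / 2 - t) (-1) y := by simpa using (hasDerivAt_id y).const_sub (1 / 2 : ℝ)
  exact h.congr_of_eventuallyEq hev

/-- `tri' = −1` on the trough piece. [cite: ElgindiLissMattingly2025, §1 (H_α, V_α)] -/
theorem hasDerivAt_triWave_trough {y : ℝ} (hy : y ∈ Ioo (-(3 / 4 : ℝ)) (-(1 / 4))) : HasDerivAt triWave (-1) y := by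
  have hev : triWave =ᶠ[nhds y] fun t => -(1 / 2) - t := by
    filter_upwards [Ioo_mem_nhds hy.1 hy.2] with t ht
    exact triWave_eq_neg_half_sub ht.1.le ht.2.le
  have h : HasDerivAt (fun t : ℝ => -(1 / 2) - t) (-1) y := by simpa using (hasDerivAt_id y).const_sub (-(1 / 2) : ℝ)
  exact h.congr_of_eventuallyEq hev

/-- The transport phase `e^{−2πias·tri(y)}` has derivative `−2πiasτ·e^{−2πias·tri(y)}` wherever `tri' = τ`. [cite: ElgindiLissMattingly2025, §1 (H_α, V_α)] -/
theorem hasDerivAt_transportExp {a s τ y : ℝ} (hτ : HasDerivAt triWave τ y) :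
    HasDerivAt (fun y : ℝ => Complex.exp (-((2 * Real.pi * a * s * triWave y : ℝ) : ℂ) * Complex.I))
      (-(((2 * Real.pi * a * s * τ : ℝ) : ℂ)) * Complex.I * Complex.exp (-((2 * Real.pi * a * s * triWave y : ℝ) : ℂ) * Complex.I)) y := by
  have h1 : HasDerivAt (fun y : ℝ => 2 * Real.pi * a * s * triWave y) (2 * Real.pi * a * s * τ) y := hτ.const_mul _
  have h2 : HasDerivAt (fun y : ℝ => -(((2 * Real.pi * a * s * triWave y : ℝ)) : ℂ) * Complex.I)
      (-(((2 * Real.pi * a * s * τ : ℝ)) : ℂ) * Complex.I) y := (h1.ofReal_comp.neg).mul_const Complex.I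
  exact h2.cexp.congr_deriv (by ring)

/-- On `(−½, ½)` minus the two kinks `±¼`, `tri' = τ(y)` with `τ = 1` on the centre piece and `τ = −1` outside. [cite: ElgindiLissMattingly2025, §1 (H_α, V_α)] -/
theorem hasDerivAt_triWave_of_mem {y : ℝ} (hy : y ∈ Ioo (-(1 / 2 : ℝ)) (1 / 2) \ ({-(1 / 4 : ℝ), 1 / 4} : Set ℝ)) :
    HasDerivAt triWave (if y ∈ Ioo (-(1 / 4 : ℝ)) (1 / 4) then (1 : ℝ) else -1) y := by
  obtain ⟨⟨h1, h2⟩, hT⟩ := hy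
  simp only [mem_insert_iff, mem_singleton_iff, not_or] at hT
  by_cases hc : y ∈ Ioo (-(1 / 4 : ℝ)) (1 / 4)
  · rw [if_pos hc]; exact hasDerivAt_triWave_centre hc
  · rw [if_neg hc]
    simp only [mem_Ioo, not_and_or, not_lt] at hc
    rcases hc with hc | hc
    · exact hasDerivAt_triWave_trough ⟨by linarith, lt_of_le_of_ne hc hT.1⟩
    · exact hasDerivAt_triWave_crest ⟨lt_of_le_of_ne hc (Ne.symm hT.2), by linarith⟩

/-- Off `0`, a real number of modulus `< 1` has non-zero fractional part. [folklore] -/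
theorem fract_ne_zero_of_abs_lt_one {x : ℝ} (h1 : -1 < x) (h2 : x < 1) (h0 : x ≠ 0) : Int.fract x ≠ 0 := by
  intro h
  have hx : x = ⌊x⌋ := by rw [Int.fract] at h; linarith
  have hl : (-1 : ℤ) < ⌊x⌋ := by exact_mod_cast (show ((-1 : ℤ) : ℝ) < ⌊x⌋ by push_cast; linarith)
  have hu : ⌊x⌋ < (1 : ℤ) := by exact_mod_cast (show ((⌊x⌋ : ℤ) : ℝ) < (1 : ℤ) by push_cast; linarith)
  have h00 : ⌊x⌋ = 0 := by omega
  exact h0 (by rw [hx, h00]; simp)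

end Summit.AnomalousDissipation.AnomalousDissipation.Theorems.SawtoothPulseCascade.K2PhaseBudget

end
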